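import Summits.RiemannHypothesis.RiemannHypothesis.Theses.EvenSectorBarta
import Summits.RiemannHypothesis.RiemannHypothesis.Theorems.GroundBartaPolarPerronFrobeniusEvenSectorDeciding
import HarnessLib

/-!
# Route `EvenSectorBarta`, item `EvenFloorDecay` (stmt-RiemannHypothesis-19955) — closed

The explicit even Barta rate `e(a) = 2(∫_{s>a} Φ(s)·2cosh(s/2) ds)·cosh(a/2)/Φ(a)` (printed theta
series `Φ`) tends to `0`: this is `GroundBartaFloor.stub_groundRateDecay` (route GroundBarta, rung 2)
once the printed series is identified with `weilThetaPhi` (`PolarPerronFrobenius.evenFloor_inlinePhi_eq`);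
the token-for-token route form is `PolarPerronFrobenius.evenFloorDecay_routeForm`
(Theorems/GroundBartaPolarPerronFrobeniusEvenSectorDeciding.lean).  RH-free.
References: Bombieri 2000 §4; de Bruijn / Rodgers–Tao 2020 eq. (2) for `Φ`.
-/

set_option linter.dupNamespace false

namespace Summit.RiemannHypothesis.RiemannHypothesis.Theorems.EvenSectorBarta

/-- **Item `EvenFloorDecay` (stmt-RiemannHypothesis-19955)**: the explicit Barta rate of the even
theta vector tends to `0` as the window grows. [folklore] -/
theorem evenFloorDecay_proof :
    Summit.RiemannHypothesis.RiemannHypothesis.Theses.EvenSectorBarta.EvenFloorDecay :=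
  Summit.RiemannHypothesis.RiemannHypothesis.Theorems.PolarPerronFrobenius.evenFloorDecay_routeForm

end Summit.RiemannHypothesis.RiemannHypothesis.Theorems.EvenSectorBarta
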